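import Mathlib
import HarnessLib
import Summits.QuantumFields.QCD.Theses.NestedDissectionSea
import Literature.MathematicalPhysics.QuantumFieldTheory.LatticeMassGapProofs

/-!
# Sketch — crux-ideate `stmt-QuantumFields-14958` (`RobustYangMillsRG`, rev 2), ideator 2, round 1

First lemmas of the two crux idea cards filed by this seat, typed over existing declarations.
Everything here is a `Prop` (a definition), so the file elaborates with no `sorry`; proofs are
not part of crux ideation.

* card `anchored-block-cyclicity` ("what no block of any anchor can see is not slow"): the
  abstract engine `AnchorGapPrinciple` — clustering of the CONNECTED diagonal correlators on a
  family of anchor sets whose span is dense forces the gap norm of the transfer operator below the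
  rate (an immediate corollary of the tree's `gapNorm_le_exp_of_dense_clustering`, Glimm–Jaffe
  Thm. 6.1.3 (iii), iterated Schwarz; provable now, S-sized) — and the two crux-level inputs it
  consumes, typed on the fine torus of the crux: `TwoTimeBlockClustering` (block observables of
  the family's own blocking, read at two fine times, decorrelate at the physical rate: the
  BLOCK CORE, the only place the format (h0) is used) and `AnchorCyclicity` (OS-density of the
  span of single-anchor block functions over all fine translates of the anchor: the whole
  fine-level content of clause (iii′), fenced by (h1)-S₄ and (h2)-link-RP).
* card `background-field-shadow` (the fibre minimiser that defines rev 2's principal part also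
  projects every fine species onto a block observable): `MinimisingSection` (a measurable section
  of the blocking attaining the fibre infimum of the fine Wilson action — Bałaban's background
  field `U_k(V)`), `ShadowTransparency` (the residual `A − A ∘ σ ∘ Bl` of a fine local observable
  has reflected autocorrelation decaying at a CUTOFF rate `c/ℓ₀`, i.e. `c·a/ℓ₀` per fine step) and
  the PSD split `ShadowSplit` (for the reflection-positive forms at even separations,
  `B(A,A) ≤ 2B(A*,A*) + 2B(A−A*,A−A*)`, elementary).
-/

namespace Summit.QuantumFields.QCD.Cruxes.RobustYangMillsRG.Ideator2

open scoped InnerProductSpace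
open MeasureTheory Filter Topology
open Literature.MathematicalPhysics.QuantumFieldTheory Literature.MathematicalPhysics.QuantumLattice
open Literature.Probability.LatticeModels

/-! ### Card 1 — the abstract engine, packaged for a family of anchors -/

/-- **Anchor gap principle.** For OS transfer data `D` (positive contraction `T`, vacuum `Ω`)
and a family of anchor sets `S i ⊆ H`: if every vector of every `S i` has its CONNECTED diagonal
correlator `⟪v, Tᵗ v⟫ − |⟪Ω, v⟫|²` bounded by `C_v e^{−m t}` (any constant), and the linear span of
`⋃ i, S i` is dense, then `‖T P_{Ω^⊥}‖ ≤ e^{−m}` — a spectral gap `m` for EVERY vector with the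
canonical constant `‖u‖ ‖v‖`. Provable now: cross terms of the span cluster at the same rate by
the Schwarz inequality for the positive forms `⟪·, Tᵗ ·⟫` on `Ω^⊥` (tree
`TransferData.norm_inner_pow_sub_le_of_eventually`), then apply the tree's
`gapNorm_le_exp_of_dense_clustering` (Glimm–Jaffe 1987 §6.1 Thm. 6.1.3 (iii), §19.7). -/
def AnchorGapPrinciple : Prop :=
  ∀ {H : Type} [NormedAddCommGroup H] [InnerProductSpace ℂ H] [CompleteSpace H]
    (D : TransferData H) (m : ℝ) (ι : Type) (S : ι → Set H),
    (∀ i, ∀ v ∈ S i, ∃ C : ℝ, ∀ t : ℕ,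
        ‖⟪v, (D.T ^ t) v⟫_ℂ - ⟪v, D.vacuum⟫_ℂ * ⟪D.vacuum, v⟫_ℂ‖ ≤ C * Real.exp (-m * t)) →
    Dense ((Submodule.span ℂ (⋃ i, S i) : Submodule ℂ H) : Set H) →
    D.gapNorm ≤ Real.exp (-m)

/-! ### The crux's fine torus: notation shared by both cards -/

/-- The gauge group of the crux. -/
abbrev SU3 : Type := ↥(Matrix.specialUnitaryGroup (Fin 3) ℂ)

/-- Product Haar measure on the fine torus `(ℤ/N)⁴`. -/
noncomputable def haar4 (N : ℕ) [NeZero N] : Measure (GaugeConfig 4 N SU3) :=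
  Measure.pi fun _ => haarProbability SU3

/-- Normalised expectation of `h` under the SIGNED fine weight `w` (the crux's `E k S`). -/
noncomputable def sExp {N : ℕ} [NeZero N] (w h : GaugeConfig 4 N SU3 → ℝ) : ℝ :=
  (∫ U, h U * w U ∂(haar4 N)) / ∫ U, w U ∂(haar4 N)

/-- Fine time shift by `n` lattice units on the torus. -/
noncomputable def timeShift {N : ℕ} [NeZero N] (n : ℕ) :
    GaugeConfig 4 N SU3 → GaugeConfig 4 N SU3 :=
  torusConfigShift (Pi.single 0 ((n : ℕ) : ZMod N))

/-- The reflection-positive form at even separation `2m`: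
`B_m(F, G) = E_w[F(θU) · G(τ_{2m} U)]` (real observables). Under (h1)+(h2) each `B_m` is
positive semidefinite on observables supported above the plane `m | m+1` (RP about that plane),
`B_0` is the OS form, and `m ↦ B_m(F,F)` is log-convex on its range (Schwarz). -/
noncomputable def rpForm {N : ℕ} [NeZero N] (w : GaugeConfig 4 N SU3 → ℝ) (m : ℕ)
    (F G : GaugeConfig 4 N SU3 → ℝ) : ℝ :=
  sExp w fun U => F (GaugeConfig.timeReflect U) * G (timeShift (2 * m) U)

/-! ### Card 1 — the two crux-level inputs, typed on the fine torus -/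

/-- **Two-time block clustering (the BLOCK CORE of card 1, torus form).** For the family's own
blocking `Bl` onto `M` blocks per axis at lattice spacing `a` (block scale `ℓ₀ = a·b`): bounded
measurable block observables, read at two fine times `n` apart, decorrelate at the physical rate
`Δ`: `|E_w[G₁(Bl U) · G₂(Bl τ_n U)] − E_w[G₁∘Bl] E_w[G₂∘Bl]| ≤ C(G₁,G₂) e^{−Δ a n}`. This is what
a block-level (RG / expansion) argument delivers; it is NOT a clause of the crux (the observables
`G ∘ Bl` grow with `k`) and it only ever uses (h0). -/
def TwoTimeBlockClustering {N M : ℕ} [NeZero N] [NeZero M] (w : GaugeConfig 4 N SU3 → ℝ)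
    (Bl : GaugeConfig 4 N SU3 → GaugeConfig 4 M SU3) (a Δ : ℝ) : Prop :=
  ∀ G₁ G₂ : GaugeConfig 4 M SU3 → ℝ, Measurable G₁ → Measurable G₂ →
    (∃ C, ∀ V, |G₁ V| ≤ C) → (∃ C, ∀ V, |G₂ V| ≤ C) →
      ∃ C : ℝ, ∀ n : ℕ, 2 * n + 1 ≤ N →
        |sExp w (fun U => G₁ (Bl U) * G₂ (Bl (timeShift n U))) -
            sExp w (G₁ ∘ Bl) * sExp w (G₂ ∘ Bl)| ≤ C * Real.exp (-(Δ * (a * n)))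

/-- **Anchor cyclicity (the FINE-LEVEL content of clause (iii′), card 1).** Every bounded
measurable positive-time fine observable is, in the OS seminorm `B₀(F,F) = E_w[F(θU)F(U)]`, a
limit of finite linear combinations of SINGLE-ANCHOR block functions `G ∘ Bl ∘ τ_v` (block
observables of fine translates `τ_v` of the family's blocking). Equivalently: no OS vector is
orthogonal to every anchored block algebra. Qualitative (no rate, no uniformity): this is all the
closed-subspace engine needs. In the Gaussian caricature the invisible directions are products
built on ALIASED modes (momenta `2πj/b` in some axis), and (h1)-S₄ + (h2)-link-RP (`T ≥ 0`, no
temporally aliased slow mode) is what kills their slow part — the place the line uses (h1),(h2). -/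
def AnchorCyclicity {N M : ℕ} [NeZero N] [NeZero M] (w : GaugeConfig 4 N SU3 → ℝ)
    (Bl : GaugeConfig 4 N SU3 → GaugeConfig 4 M SU3) : Prop :=
  ∀ F : GaugeConfig 4 N SU3 → ℝ, Measurable F → (∃ C, ∀ U, |F U| ≤ C) →
    IsPositiveTimeObservable F →
    ∀ ε : ℝ, 0 < ε →
      ∃ (s : Finset (Site 4 N × (GaugeConfig 4 M SU3 → ℝ))),
        (∀ p ∈ s, Measurable p.2 ∧ (∃ C, ∀ V, |p.2 V| ≤ C) ∧
          IsPositiveTimeObservable (fun U : GaugeConfig 4 N SU3 => p.2 (Bl (torusConfigShift p.1 U)))) ∧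
        let R : GaugeConfig 4 N SU3 → ℝ :=
          fun U => F U - ∑ p ∈ s, p.2 (Bl (torusConfigShift p.1 U))
        rpForm w 0 R R ≤ ε

/-! ### Card 2 — background-field shadows -/

/-- **A minimising section of the blocking** (Bałaban's background field `U_k(V)`): a measurable
right inverse `σ` of `Bl` attaining the fibre infimum of the FINE Wilson action — the very object
whose value `wilsonAction ρ (σ V) = A_Bl(V)` is rev 2's principal part. -/
def MinimisingSection {N M : ℕ} [NeZero N] [NeZero M]
    (Bl : GaugeConfig 4 N SU3 → GaugeConfig 4 M SU3) (σ : GaugeConfig 4 M SU3 → GaugeConfig 4 N SU3) :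
    Prop :=
  Measurable σ ∧ (∀ V, Bl (σ V) = V) ∧
    ∀ V, wilsonAction (fundamentalRep (Fin 3)) (σ V) =
      ⨅ U : {U : GaugeConfig 4 N SU3 // Bl U = V}, wilsonAction (fundamentalRep (Fin 3)) U.1

/-- **Shadow transparency (the FIBRE stub of card 2).** For a fine bounded measurable
positive-time observable `A`, its background-field SHADOW `A* := A ∘ σ ∘ Bl` is a block
observable, and the residual `R := A − A*` is ULTRAVIOLET: its reflected autocorrelation
`B_m(R,R)` decays at a cutoff rate — `c` per BLOCK of fine time, i.e. `e^{−c·(2m)/b}` — with a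
constant controlled by the OS norm of `A`. For Gibbsian fine weights this is the exponential decay
of Bałaban's fluctuation covariance under the averaging constraint (CMP 116 (1.4)); for a general
admissible `w` it is the honest fine-level hypothesis any proof of (i′)/(ii)/(iii′) must add. -/
def ShadowTransparency {N M : ℕ} [NeZero N] [NeZero M] (w : GaugeConfig 4 N SU3 → ℝ)
    (Bl : GaugeConfig 4 N SU3 → GaugeConfig 4 M SU3) (σ : GaugeConfig 4 M SU3 → GaugeConfig 4 N SU3)
    (b : ℕ) (c K : ℝ) : Prop :=
  ∀ A : GaugeConfig 4 N SU3 → ℝ, Measurable A → (∃ C, ∀ U, |A U| ≤ C) →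
    IsPositiveTimeObservable A →
      let R : GaugeConfig 4 N SU3 → ℝ := fun U => A U - A (σ (Bl U))
      ∀ m : ℕ, 4 * m + 1 ≤ N →
        rpForm w m R R ≤ K * rpForm w 0 A A * Real.exp (-(c * ((2 * m : ℕ) : ℝ) / b))

/-- **Shadow split (elementary, card 2).** For a positive semidefinite symmetric form,
`B(x+y, x+y) ≤ 2 B(x,x) + 2 B(y,y)`; applied to the RP forms at even separations with
`A = A* + R` it turns TWO-TIME BLOCK clustering of the shadow `A* = A ∘ σ ∘ Bl` (card 1's block
core, for the block observable `A ∘ σ`) plus `ShadowTransparency` into clustering of the fine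
observable `A` at rate `min(Δ, c/ℓ₀)`, with honest constants, directly on the torus. -/
def ShadowSplit : Prop :=
  ∀ (V : Type) [AddCommGroup V] [Module ℝ V] (B : V →ₗ[ℝ] V →ₗ[ℝ] ℝ),
    (∀ x y, B x y = B y x) → (∀ x, 0 ≤ B x x) →
      ∀ x y : V, B (x + y) (x + y) ≤ 2 * B x x + 2 * B y y

/-- **Principal-density non-Gaussianity (the (ii)-stub of card 2, block level).** Under ANY
format density at block coupling `βl ≥ β₀` the smeared block-curvature of the MINIMISER — the
shadow of the fine curvature species, `V ↦ Σ_x f(x) (3 − Re tr ρ(U_p(σ V)))`-type — has a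
connected three-point function bounded away from zero by `c βl⁻³` at block separation ≤ 2: its
leading term is the universal Gaussian-gluon energy-density cumulant (Wick: `8 tr(QCQ'CQ''C) ≠ 0`),
`W` entering at relative order `βl^{-1/2}`. A ONE-scale small-field expansion + rough-block
dilution statement (Bałaban-grade, not Clay-grade). Typed abstractly: three bounded block
observables with prescribed expectations have a non-vanishing third cumulant. -/
def ThirdCumulantNonzero {N M : ℕ} [NeZero N] [NeZero M] (w : GaugeConfig 4 N SU3 → ℝ)
    (Bl : GaugeConfig 4 N SU3 → GaugeConfig 4 M SU3) (X Y Z : GaugeConfig 4 M SU3 → ℝ) (c : ℝ) :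
    Prop :=
  let e : (GaugeConfig 4 M SU3 → ℝ) → ℝ := fun G => sExp w (G ∘ Bl)
  c ≤ |e (fun V => X V * Y V * Z V) - e X * e (fun V => Y V * Z V) - e Y * e (fun V => X V * Z V)
        - e Z * e (fun V => X V * Y V) + 2 * (e X * e Y * e Z)|

end Summit.QuantumFields.QCD.Cruxes.RobustYangMillsRG.Ideator2
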